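import Literature.NumberTheory.NumberFields.DiscriminantSquareRoot
import Literature.NumberTheory.NumberFields.StickelbergerDiscriminant
import Literature.NumberTheory.NumberFields.UnramifiedDiscriminant
import Literature.NumberTheory.NumberFields.UnramifiedViaInertia
import Literature.NumberTheory.QuadraticFields.FundamentalDiscriminantResolvent
import HarnessLib

/-!
# `d(K₃) = d(K₂)`: the discriminant of a cubic field whose Galois closure is unramified over
# its quadratic resolvent field (Hasse 1930)

Topic `NumberTheory/NumberFields`.  Theorem-only file (no definition, no named fact).

Let `E/ℚ` be a Galois sextic number field containing a quadratic subfield `K` such that `E/K` is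
unramified at all finite primes (Mathlib: `Algebra.IsUnramifiedAt (𝓞 K) Q` for every maximal
ideal `Q ⊆ 𝓞 E`), and let `F ⊆ E` be a cubic subfield.  Then

* `not_isGalois_cubic_of_unramified` — `E` has **no cubic subfield Galois over `ℚ`**: a cyclic
  cubic field has a (totally) ramified prime (Minkowski), whose inertia group in `Gal(E/ℚ)` would
  have order divisible by `3`; but `E/K` unramified forces `I(Q) ∩ Gal(E/K) = 1`, so `#I(Q) ≤ 2`
  (`card_inertia_le_two_of_unramified`).  Hence `Gal(E/ℚ) ≅ S₃` and the normal closure of `F`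
  in `E` is all of `E` (`normalClosure_eq_top_of_unramified`).
* `exists_mem_sq_eq_discr_of_cubic` — **`√d_F ∈ K ∖ ℚ`**: the square root `δ = det(σᵢ ωⱼ)` of
  `d_F` in `E` transforms under `Gal(E/ℚ) ↪ S₃` by the sign character, so it is fixed by the
  subgroup `Gal(E/K)` of odd order `3` and is not rational
  (`exists_sq_eq_discr_mem_fixedField_not_mem_range`, `DiscriminantSquareRoot.lean`); hence
  `d_K = d_F · q²` with `q ∈ ℚˣ` (`exists_discr_eq_discr_mul_sq`).
* `discr_sq_dvd_discr_pow_three` — **`d_F² ∣ d_K³`**: `|d_E| = |d_K|³` as `E/K` is unramified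
  (`natAbs_discr_eq_pow_of_forall_isUnramifiedAt`, Neukirch III (2.9)–(2.10)) and
  `|d_F|^{[E:F]} ∣ |d_E|` (Mathlib's discriminant tower
  `NumberField.natAbs_discr_eq_absNorm_differentIdeal_mul_natAbs_discr_pow`).
* `discr_eq_discr_of_unramified` — **`d_F = d_K`**: `d_K` is a fundamental discriminant
  (`Quadratic.isFundamentalDiscriminant_discr`), `d_F ≡ 0, 1 (mod 4)` (Stickelberger,
  `stickelberger_discr_emod_four`), and a fundamental discriminant is rigid in its rational square
  class under `d² ∣ D³` (`Quadratic.eq_of_isFundamental_of_eq_mul_sq_of_sq_dvd_pow_three`).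

This is the discriminant half of Hasse's correspondence between cubic fields of fundamental
discriminant `D` and unramified cyclic cubic extensions of `ℚ(√D)` (H. Hasse, *Arithmetische
Theorie der kubischen Zahlkörper auf klassenkörpertheoretischer Grundlage*, Math. Z. 31 (1930),
565–582, Satz on `d(K₃) = d(K₂) f²` with conductor `f = 1` in the unramified case), in the form
used by Davenport–Heilbronn (Proc. Roy. Soc. A 322 (1971), §6, Prop. 5 ff.) and Bhargava–Varma
(arXiv:1401.5875, §5.3, Prop. 35) to pass between `3`-torsion in `Cl(ℚ(√D))` and cubic fields of
discriminant `D`.  The proof here is the elementary one via inertia groups, the resolvent square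
root and the different, using only Mathlib and proved Literature files.

## References

* H. Hasse, Math. Z. 31 (1930) 565–582. [Hasse1930]
* H. Davenport, H. Heilbronn, *On the density of discriminants of cubic fields. II*,
  Proc. Roy. Soc. London A 322 (1971), 405–420, §6. [DavenportHeilbronn1971]
* M. Bhargava, I. Varma, *The mean number of 3-torsion elements in the class groups and ideal
  groups of quadratic orders*, Proc. LMS 112 (2016), §5.3. [BhargavaVarma2016]
* J. Neukirch, *Algebraic Number Theory* (1999), Ch. III (2.6), (2.9), (2.10). [NeukirchANT1999]
* J.-P. Serre, *Local Fields*, Ch. I §7, Prop. 21–22. [SerreLocalFields1979]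
-/

noncomputable section

-- the `Algebra ℚ ↥K` diamond (`IntermediateField.algebra` vs `DivisionRing.toRatAlgebra`) is only
-- defeq at default transparency; let instance unification see through it (as Mathlib does in
-- `NumberField.linearDisjoint_of_isGalois_isCoprime_discr`).
set_option backward.isDefEq.respectTransparency false

open NumberField Module Ideal IntermediateField
open Literature.NumberTheory.QuadraticFields

namespace Literature.NumberTheory.NumberFields

variable {E : Type*} [Field E] [NumberField E] [IsGalois ℚ E]

/-! ## Inertia groups in an extension unramified over a quadratic subfield -/

/-- `[Gal(E/ℚ) : Gal(E/K)] = [K : ℚ]` for a subfield `K` of the Galois number field `E`.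
[folklore] -/
theorem index_fixingSubgroup_eq_finrank (K : IntermediateField ℚ E) :
    K.fixingSubgroup.index = finrank ℚ K := by
  have h1 := K.fixingSubgroup.card_mul_index
  rw [IsGalois.card_fixingSubgroup_eq_finrank K, IsGalois.card_aut_eq_finrank,
    ← Module.finrank_mul_finrank ℚ K E, mul_comm] at h1
  exact Nat.eq_of_mul_eq_mul_right (Module.finrank_pos (R := K) (M := E)) h1

/-- If the maximal ideal `Q ⊆ 𝓞 E` is unramified over `𝓞 K` for a subfield `K ⊆ E`, then the
inertia group of `Q` in `Gal(E/ℚ)` meets `Gal(E/K)` trivially: `#(I(Q) ∩ Gal(E/K)) = e(Q | 𝓞 K) = 1`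
(Serre, *Local Fields*, Ch. I §7, Prop. 22). [cite: SerreLocalFields1979, Ch. I §7 Prop. 22] -/
theorem inertia_inf_fixingSubgroup_eq_bot (K : IntermediateField ℚ E) (Q : Ideal (𝓞 E))
    [Q.IsMaximal] [Algebra.IsUnramifiedAt (𝓞 K) Q] :
    Q.inertia (E ≃ₐ[ℚ] E) ⊓ K.fixingSubgroup = ⊥ := by
  haveI : IsGaloisGroup K.fixingSubgroup K E :=
    IsGaloisGroup.intermediateField (E ≃ₐ[ℚ] E) ℚ E K
  have h := card_inertia_eq_card_inf_range E Q K.fixingSubgroup.subtype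
    K.fixingSubgroup.subtype_injective (fun _ _ => rfl)
  rw [Subgroup.range_subtype, card_inertia_eq_ramificationIdx E K.fixingSubgroup K Q,
    Ideal.ramificationIdx_eq_one_of_isUnramifiedAt] at h
  rw [← Subgroup.card_eq_one]
  exact h.symm

/-- If `E/K` is unramified at `Q` for a *quadratic* subfield `K ⊆ E`, then the inertia group of
`Q` in `Gal(E/ℚ)` has order at most `2` (it injects into `Gal(E/ℚ)/Gal(E/K)`, of order `[K:ℚ] = 2`;
equivalently `e(Q|ℤ) = e(Q ∩ 𝓞 K | ℤ) ≤ 2`). [folklore] -/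
theorem card_inertia_le_two_of_unramified (K : IntermediateField ℚ E) (hK : finrank ℚ K = 2)
    (Q : Ideal (𝓞 E)) [Q.IsMaximal] [Algebra.IsUnramifiedAt (𝓞 K) Q] :
    Nat.card (Q.inertia (E ≃ₐ[ℚ] E)) ≤ 2 := by
  have hbot := inertia_inf_fixingSubgroup_eq_bot K Q
  have h1 : (Q.inertia (E ≃ₐ[ℚ] E) ⊓ K.fixingSubgroup).index ≤
      (Q.inertia (E ≃ₐ[ℚ] E)).index * K.fixingSubgroup.index := Subgroup.index_inf_le
  rw [hbot, Subgroup.index_bot, index_fixingSubgroup_eq_finrank K, hK] at h1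
  have h2 := (Q.inertia (E ≃ₐ[ℚ] E)).card_mul_index
  have hG : 0 < Nat.card (E ≃ₐ[ℚ] E) := Nat.card_pos
  refine Nat.le_of_mul_le_mul_left ?_ hG
  calc Nat.card (E ≃ₐ[ℚ] E) * Nat.card (Q.inertia (E ≃ₐ[ℚ] E))
        ≤ (Q.inertia (E ≃ₐ[ℚ] E)).index * 2 * Nat.card (Q.inertia (E ≃ₐ[ℚ] E)) :=
          Nat.mul_le_mul_right _ h1
    _ = Nat.card (E ≃ₐ[ℚ] E) * 2 := by rw [← h2]; ring

omit [IsGalois ℚ E] in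
/-- An inertia group of order `≤ 2` in `Gal(E/ℚ)` acts trivially on every cubic subfield `C ⊆ E`
that is Galois over `ℚ`: its image in `Gal(C/ℚ)`, a group of order `3`, is killed by `2`.
[folklore] -/
theorem inertia_le_fixingSubgroup_of_isGalois_cubic (C : IntermediateField ℚ E) [IsGalois ℚ C]
    (hC : finrank ℚ C = 3) (Q : Ideal (𝓞 E)) [Q.IsMaximal]
    (hI : Nat.card (Q.inertia (E ≃ₐ[ℚ] E)) ≤ 2) :
    Q.inertia (E ≃ₐ[ℚ] E) ≤ C.fixingSubgroup := by
  intro σ hσ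
  -- `σ² = 1`
  have hσ2 : σ ^ 2 = 1 := by
    have hpos : 0 < Nat.card (Q.inertia (E ≃ₐ[ℚ] E)) := Nat.card_pos
    rcases Nat.lt_or_ge (Nat.card (Q.inertia (E ≃ₐ[ℚ] E))) 2 with hlt | hge
    · have h1 : Nat.card (Q.inertia (E ≃ₐ[ℚ] E)) = 1 := by omega
      rw [Subgroup.card_eq_one] at h1
      rw [h1] at hσ
      rw [Subgroup.mem_bot.mp hσ, one_pow]
    · have h2 : Nat.card (Q.inertia (E ≃ₐ[ℚ] E)) = 2 := le_antisymm hI hge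
      have h := pow_card_eq_one' (x := (⟨σ, hσ⟩ : Q.inertia (E ≃ₐ[ℚ] E)))
      rw [h2] at h
      simpa using congrArg Subtype.val h
  -- the restriction `τ` of `σ` to `C` satisfies `τ² = 1 = τ³`, so `τ = 1`
  set τ := AlgEquiv.restrictNormalHom C σ with hτ
  have hτ2 : τ ^ 2 = 1 := by rw [hτ, ← map_pow, hσ2, map_one]
  have hτ3 : τ ^ 3 = 1 := by
    have h := pow_card_eq_one' (x := τ)
    rwa [IsGalois.card_aut_eq_finrank, hC] at h
  have hτ1 : τ = 1 := by
    calc τ = τ ^ 2 * τ := by rw [hτ2, one_mul]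
      _ = τ ^ 3 := by rw [← pow_succ]
      _ = 1 := hτ3
  rw [IntermediateField.mem_fixingSubgroup_iff]
  exact (AlgEquiv.restrictNormal_eq_one_iff C σ).mp hτ1

/-- **No cyclic cubic subfield.**  If the Galois number field `E` is unramified over a quadratic
subfield `K` at every finite prime, then `E` contains no cubic subfield `C` Galois over `ℚ`.
(By Minkowski some prime `q` of `C` is ramified over `ℤ`; for `Q ⊆ 𝓞 E` above `q` this says
`I(Q) ⊄ Gal(E/C)` (`isUnramifiedAt_under_iff_inertia_le`), contradicting the previous two lemmas.)
In particular `Gal(E/ℚ)` is not abelian when `[E:ℚ] = 6`. [folklore] -/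
theorem not_isGalois_cubic_of_unramified (K : IntermediateField ℚ E) (hK : finrank ℚ K = 2)
    (hunr : ∀ (Q : Ideal (𝓞 E)) [Q.IsMaximal], Algebra.IsUnramifiedAt (𝓞 K) Q)
    (C : IntermediateField ℚ E) [IsGalois ℚ C] (hC : finrank ℚ C = 3) : False := by
  obtain ⟨q, hqmax, hq⟩ :=
    NumberField.exists_not_isUnramifiedAt_int (K := C) (𝒪 := 𝓞 C) (by rw [hC]; decide)
  obtain ⟨Q, hQmax, hQq⟩ := exists_maximal_ideal_liesOver_of_isIntegral (S := 𝓞 E) q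
  have hq' : q = Q.under (𝓞 C) := hQq.over
  subst hq'
  haveI := hunr Q
  exact hq ((isUnramifiedAt_under_iff_inertia_le E C Q).mpr
    (inertia_le_fixingSubgroup_of_isGalois_cubic C hC Q (card_inertia_le_two_of_unramified K hK Q)))

/-- **The Galois closure of a cubic subfield is everything.**  If the Galois sextic `E` is
unramified over its quadratic subfield `K` at every finite prime and `F ⊆ E` is a cubic subfield,
then the normal closure of `F/ℚ` in `E` is `E` (it has degree `3` or `6`, and degree `3` would
make it a cyclic cubic subfield). [folklore] -/
theorem normalClosure_eq_top_of_unramified (K F : IntermediateField ℚ E) (hK : finrank ℚ K = 2)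
    (hF : finrank ℚ F = 3) (hE : finrank ℚ E = 6)
    (hunr : ∀ (Q : Ideal (𝓞 E)) [Q.IsMaximal], Algebra.IsUnramifiedAt (𝓞 K) Q) :
    normalClosure ℚ F E = ⊤ := by
  set N := normalClosure ℚ F E with hN
  have hFN : F ≤ N := IntermediateField.le_normalClosure F
  have h3 : 3 ∣ finrank ℚ N := hF ▸ IntermediateField.finrank_dvd_of_le_right hFN
  have h6 : finrank ℚ N ∣ 6 := hE ▸ Dvd.intro _ (Module.finrank_mul_finrank ℚ N E)
  -- `finrank ℚ N ∈ {3, 6}`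
  have hN36 : finrank ℚ N = 3 ∨ finrank ℚ N = 6 := by
    have hle : finrank ℚ N ≤ 6 := Nat.le_of_dvd (by norm_num) h6
    obtain ⟨k, hk⟩ := h3
    interval_cases h : finrank ℚ N <;> omega
  rcases hN36 with h3' | h6'
  · -- `N` would be a cyclic cubic subfield
    haveI : Algebra.IsSeparable ℚ N := Algebra.IsAlgebraic.isSeparable_of_perfectField
    haveI : IsGalois ℚ N := ⟨⟩
    exact (not_isGalois_cubic_of_unramified K hK hunr N h3').elim
  · exact IntermediateField.eq_of_le_of_finrank_eq le_top
      (h6'.trans (hE ▸ IntermediateField.finrank_top'.symm))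

/-! ## The resolvent square root and the discriminant identity -/

/-- **`√d_F ∈ K ∖ ℚ`.**  Let `E/ℚ` be a Galois sextic, `K ⊆ E` a quadratic and `F ⊆ E` a cubic
subfield whose normal closure is `E`.  Then `d_F = δ²` for some `δ ∈ K` which is not rational:
`δ = det(σᵢ ωⱼ)` for an integral basis `ω` of `F` and the three embeddings `σᵢ : F → E`, on which
`Gal(E/ℚ) ↪ S₃` acts through the sign character, trivially on the subgroup `Gal(E/K)` of order `3`.
[folklore] -/
theorem exists_mem_sq_eq_discr_of_cubic (K F : IntermediateField ℚ E) (hK : finrank ℚ K = 2)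
    (hF : finrank ℚ F = 3) (hE : finrank ℚ E = 6) (hgen : normalClosure ℚ F E = ⊤) :
    ∃ δ : E, δ ∈ K ∧ δ ^ 2 = ((discr F : ℤ) : E) ∧ δ ∉ Set.range (algebraMap ℚ E) := by
  have hcardF : Fintype.card (F →ₐ[ℚ] E) = finrank ℚ F :=
    AlgHom.card_of_splits ℚ F E fun x => by
      rw [← minpoly.algebraMap_eq (algebraMap F E).injective x]
      exact Normal.splits (inferInstance : Normal ℚ E) _
  have hKE : finrank K E = 3 := by
    have h := Module.finrank_mul_finrank ℚ K E
    rw [hK, hE] at h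
    omega
  have hH : Odd (Nat.card K.fixingSubgroup) := by
    rw [IsGalois.card_fixingSubgroup_eq_finrank K, hKE]
    exact Nat.odd_iff.mpr (by norm_num)
  have hbig : (finrank ℚ F).factorial < 2 * Nat.card (E ≃ₐ[ℚ] E) := by
    rw [IsGalois.card_aut_eq_finrank, hF, hE]
    decide
  have hgen' : ⨆ σ : F →ₐ[ℚ] E, σ.fieldRange = ⊤ := by
    rw [← normalClosure_def]; exact hgen
  obtain ⟨δ, hδH, hsq, hnot⟩ := exists_sq_eq_discr_mem_fixedField_not_mem_range F E hcardF
    (by rw [hF]; norm_num) hgen' hbig K.fixingSubgroup hH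
  rw [IsGalois.fixedField_fixingSubgroup] at hδH
  exact ⟨δ, hδH, hsq, hnot⟩

/-- **`d_K = d_F q²`.**  Under the hypotheses of `exists_mem_sq_eq_discr_of_cubic`, the
discriminant of the quadratic subfield `K = ℚ(√d_F)` is `d_F` times a nonzero rational square
(`NumberField.exists_discr_eq_mul_sq`). [folklore] -/
theorem exists_discr_eq_discr_mul_sq (K F : IntermediateField ℚ E) (hK : finrank ℚ K = 2)
    (hF : finrank ℚ F = 3) (hE : finrank ℚ E = 6) (hgen : normalClosure ℚ F E = ⊤) :
    ∃ q : ℚ, q ≠ 0 ∧ (discr K : ℚ) = ((discr F : ℤ) : ℚ) * q ^ 2 := by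
  obtain ⟨δ, hδK, hsq, hnot⟩ := exists_mem_sq_eq_discr_of_cubic K F hK hF hE hgen
  have hθ : (⟨δ, hδK⟩ : K) ∉ Set.range (algebraMap ℚ K) := by
    rintro ⟨r, hr⟩
    apply hnot
    refine ⟨r, ?_⟩
    have h := congrArg (algebraMap K E) hr
    rw [← IsScalarTower.algebraMap_apply] at h
    exact h
  have hc : (⟨δ, hδK⟩ : K) ^ 2 = algebraMap ℚ K ((discr F : ℤ) : ℚ) := by
    apply (algebraMap K E).injective
    rw [map_pow, ← IsScalarTower.algebraMap_apply, map_intCast]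
    exact hsq
  exact NumberField.exists_discr_eq_mul_sq hK hθ hc

/-- **`d_F² ∣ d_K³`.**  If the Galois sextic `E` is unramified over its quadratic subfield `K` at
all finite primes and `F ⊆ E` is cubic, then `d_F² ∣ d_K³`: indeed `|d_E| = |d_K|³` (Neukirch III
(2.9)–(2.10) with trivial relative different) and `|d_F|² ∣ |d_E|` (discriminant tower for
`F ⊆ E`). [cite: NeukirchANT1999, Ch. III Cor. (2.10)] -/
theorem discr_sq_dvd_discr_pow_three (K F : IntermediateField ℚ E) (hK : finrank ℚ K = 2)
    (hF : finrank ℚ F = 3) (hE : finrank ℚ E = 6)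
    (hunr : ∀ (Q : Ideal (𝓞 E)) [Q.IsMaximal], Algebra.IsUnramifiedAt (𝓞 K) Q) :
    discr F ^ 2 ∣ discr K ^ 3 := by
  have hKE : finrank K E = 3 := by
    have h := Module.finrank_mul_finrank ℚ K E
    rw [hK, hE] at h
    omega
  have hFE : finrank F E = 2 := by
    have h := Module.finrank_mul_finrank ℚ F E
    rw [hF, hE] at h
    omega
  have h1 : (discr E).natAbs = (discr K).natAbs ^ 3 := by
    rw [← hKE]
    exact natAbs_discr_eq_pow_of_forall_isUnramifiedAt hunr
  have h2 := NumberField.natAbs_discr_eq_absNorm_differentIdeal_mul_natAbs_discr_pow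
    F (𝓞 F) E (𝓞 E)
  rw [hFE] at h2
  have h3 : (discr F).natAbs ^ 2 ∣ (discr K).natAbs ^ 3 := by
    rw [← h1]
    exact Dvd.intro_left _ h2.symm
  rwa [← Int.natAbs_pow, ← Int.natAbs_pow, Int.natAbs_dvd_natAbs] at h3

/-- **`d_F = d_K`** (with the normal-closure hypothesis explicit).  Let `E/ℚ` be a Galois sextic
unramified at all finite primes over its quadratic subfield `K`, and `F ⊆ E` a cubic subfield with
normal closure `E`.  Then `d_F = d_K`: `d_K` is fundamental, `d_K = d_F q²`, `d_F ≡ 0, 1 (mod 4)`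
(Stickelberger) and `d_F² ∣ d_K³`, and a fundamental discriminant is the only such `d`
(`Quadratic.eq_of_isFundamental_of_eq_mul_sq_of_sq_dvd_pow_three`).
[cite: Hasse1930, `d(K₃) = d(K₂) f²` with `f = 1`] -/
theorem discr_eq_discr_of_unramified_of_normalClosure_eq_top (K F : IntermediateField ℚ E)
    (hK : finrank ℚ K = 2) (hF : finrank ℚ F = 3) (hE : finrank ℚ E = 6)
    (hgen : normalClosure ℚ F E = ⊤)
    (hunr : ∀ (Q : Ideal (𝓞 E)) [Q.IsMaximal], Algebra.IsUnramifiedAt (𝓞 K) Q) :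
    discr F = discr K := by
  obtain ⟨q, -, hq⟩ := exists_discr_eq_discr_mul_sq K F hK hF hE hgen
  exact Quadratic.eq_of_isFundamental_of_eq_mul_sq_of_sq_dvd_pow_three
    (Quadratic.isFundamentalDiscriminant_discr hK) (stickelberger_discr_emod_four F) hq
    (discr_sq_dvd_discr_pow_three K F hK hF hE hunr)

/-- **Hasse: `d(K₃) = d(K₂)` in the unramified case.**  Let `E/ℚ` be a Galois number field of
degree `6`, `K ⊆ E` a quadratic subfield such that every maximal ideal of `𝓞 E` is unramified over
`𝓞 K`, and `F ⊆ E` a cubic subfield.  Then `disc F = disc K`.  (Hasse, Math. Z. 31 (1930): a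
non-cyclic cubic field `K₃` with quadratic resolvent field `K₂` has `d(K₃) = d(K₂) f²`, `f` the
conductor of the cyclic cubic extension `K₃K₂/K₂`; here `f = 1`.  This is the direction
"unramified cubic extension of `ℚ(√D)` ↦ cubic field of discriminant `D`" of the correspondence
used in Davenport–Heilbronn §6 and Bhargava–Varma Prop. 35.)
[cite: Hasse1930, Math. Z. 31, `d(K₃) = d(K₂) f²`; BhargavaVarma2016, §5.3 Prop. 35] -/
theorem discr_eq_discr_of_unramified (K F : IntermediateField ℚ E) (hK : finrank ℚ K = 2)
    (hF : finrank ℚ F = 3) (hE : finrank ℚ E = 6)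
    (hunr : ∀ (Q : Ideal (𝓞 E)) [Q.IsMaximal], Algebra.IsUnramifiedAt (𝓞 K) Q) :
    discr F = discr K :=
  discr_eq_discr_of_unramified_of_normalClosure_eq_top K F hK hF hE
    (normalClosure_eq_top_of_unramified K F hK hF hE hunr) hunr

end Literature.NumberTheory.NumberFields

end
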